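import Mathlib

/-!
# Tier4/Line1/RationalSolutions — a rational linear system with a unique solution over a `k`-algebra has a rational one

Blind re-derivation cell `pub-hodge-repro`, Tier 4 «prove the step» (README §9–§10), seat t4-L1-p2 (prover, gen 0),
LINE L1, support for (iii′) `exists_rational_conj` (the core of J2.b, plan-1 g1's cut S12586 (C)(5)).

THE LEMMA (Mathlib only; `k` a field, `R` a `k`-algebra): let `f : V →ₗ[k] W` be `k`-linear between finite-dimensional
`k`-spaces and `F : V_R →ₗ[R] W_R` an `R`-linear map between `R`-modules carrying `k`-bases that are the images of
`k`-bases of `V`, `W` under `k`-linear «inclusions» `ιV`, `ιW`, with `F ∘ ιV = ιW ∘ f`.  If `F` has trivial kernel,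
then every solution `z` of `F z = ιW b` with `b` RATIONAL is rational: `z = ιV v` for some `v : V`.
PROOF: `f` is injective, so it has a `k`-linear left inverse `g` (`LinearMap.exists_leftInverse_of_injective`); the
`R`-linear map `G` defined on the `R`-basis of `W_R` by `G (ιW (bW j)) := ιV (g (bW j))` (`Basis.constr`) satisfies
`G ∘ ιW = ιV ∘ g` (both `k`-linear, equal on the basis) and `G ∘ F = id` (both `R`-linear, equal on the `R`-basis
`ιV (bV i)`), so `z = G (F z) = G (ιW b) = ιV (g b)`.

Nothing here says anything about the status of the Hodge conjecture for CM abelian varieties, which is NOT proved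
(HC_CM is NOT proved by anyone in this repository).
-/

set_option autoImplicit false

noncomputable section

namespace Summit.Ventures.HodgeRepro.Tier4.Line1

open Module

section RationalSolutions

variable {k : Type} [Field k] {R : Type} [CommRing R] [Algebra k R]
variable {V W : Type} [AddCommGroup V] [Module k V] [AddCommGroup W] [Module k W]
variable {VR WR : Type} [AddCommGroup VR] [Module R VR] [Module k VR] [IsScalarTower k R VR]
  [AddCommGroup WR] [Module R WR] [Module k WR] [IsScalarTower k R WR]
variable {ι κ : Type}

/-- **a rational linear system with a unique solution has a rational one** (see the module docstring). -/
theorem exists_rational_of_unique (bV : Basis ι k V) (bW : Basis κ k W) (bVR : Basis ι R VR)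
    (bWR : Basis κ R WR) (ιV : V →ₗ[k] VR) (ιW : W →ₗ[k] WR) (hιV : ∀ i, ιV (bV i) = bVR i)
    (hιW : ∀ j, ιW (bW j) = bWR j) (hιVinj : Function.Injective ιV)
    (f : V →ₗ[k] W) (F : VR →ₗ[R] WR) (hcompat : ∀ v, F (ιV v) = ιW (f v))
    (hinj : ∀ z, F z = 0 → z = 0) {z : VR} {b : W} (hz : F z = ιW b) : ∃ v : V, z = ιV v := by
  -- `f` is injective
  have hf : LinearMap.ker f = ⊥ := by
    rw [LinearMap.ker_eq_bot']
    intro v hv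
    have h1 : F (ιV v) = 0 := by rw [hcompat, hv, map_zero]
    have h2 : ιV v = 0 := hinj _ h1
    rw [← map_zero ιV] at h2
    exact hιVinj h2
  obtain ⟨g, hg⟩ := f.exists_leftInverse_of_injective hf
  have hgf : ∀ v, g (f v) = v := fun v => by
    have := LinearMap.congr_fun hg v
    simpa using this
  -- the `R`-linear extension of `g`
  set G : WR →ₗ[R] VR := bWR.constr R (fun j => ιV (g (bW j))) with hG
  have hGι : ∀ w, G (ιW w) = ιV (g w) := by
    have : (G.restrictScalars k).comp ιW = ιV.comp g := by
      apply bW.ext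
      intro j
      simp only [LinearMap.comp_apply, LinearMap.restrictScalars_apply, hιW j, hG, Basis.constr_basis]
    intro w
    have := LinearMap.congr_fun this w
    simpa using this
  have hGF : G.comp F = LinearMap.id := by
    apply bVR.ext
    intro i
    simp only [LinearMap.comp_apply, LinearMap.id_apply]
    rw [← hιV i, hcompat, hGι, hgf, hιV i]
  refine ⟨g b, ?_⟩
  have := LinearMap.congr_fun hGF z
  simp only [LinearMap.comp_apply, LinearMap.id_apply] at this
  rw [← this, hz, hGι]

end RationalSolutions

end Summit.Ventures.HodgeRepro.Tier4.Line1

end
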